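import Summits.Ventures.CertifiedManyBodySolver.Conjectures.OneBodySection
import Mathlib.Analysis.SpecialFunctions.Trigonometric.Basic
import Mathlib.Algebra.BigOperators.Fin

/-!
# Twisted-ring primal certificate for the one-body section value (C-M1D-4, lower half)

HONEST FRAMING: first certified bounds; not a superconductivity verdict; every number certified or labelled float.

For `S ≥ 2` sites and `N ≤ S` particles per spin species, the *parity-twisted ring* section
`g_N(v) = (1/S) ∑_{j<N} cos(k_j v)`, `k_j = (2j+1-N)π/S`, is a feasible point of the one-body section
problem of `OneBodySection.lean`: `0 ⪯ T_S(g_N) ⪯ 1`, `g_N(0) = N/S`, and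
`g_N(1) = sin(Nπ/S) / (S sin(π/S))`.  Hence the section value at commensurate filling is at least the
twisted-ring envelope (T-M1D.13 of the m1-4 STRUCTURE file; the matching dual certificate is the paper
proof C-M1D-4a).  The two positivity statements are Gram factorisations over the occupied resp.
unoccupied momenta; the only analytic input is the telescoping sum
`2 sin θ ∑_{j<M} cos((2j+1-N)θ) = sin((2M-N)θ) + sin(Nθ)` and its vanishing over a full period.
-/

namespace Summit.Ventures.CertifiedManyBodySolver.Conjectures

open Matrix Finset Real

/-- The twisted momenta `k_j = (2j+1-N)π/S`. -/
noncomputable def twistedMomentum (S N j : ℕ) : ℝ := (2 * (j : ℝ) + 1 - N) * (π / S)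

/-- The twisted-ring section `g_N(v) = (1/S) ∑_{j<N} cos(k_j v)`. -/
noncomputable def twistedSection (S N : ℕ) (v : ℕ) : ℝ :=
  (∑ j ∈ range N, Real.cos (twistedMomentum S N j * v)) / S

/-- Telescoping: `2 sin θ ∑_{j<M} cos((2j+1-N)θ) = sin((2M-N)θ) + sin(Nθ)`. -/
theorem two_sin_mul_sum_cos (N M : ℕ) (θ : ℝ) :
    2 * Real.sin θ * ∑ j ∈ range M, Real.cos ((2 * (j : ℝ) + 1 - N) * θ)
      = Real.sin ((2 * (M : ℝ) - N) * θ) + Real.sin (N * θ) := by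
  induction M with
  | zero => simp
  | succ M ih =>
    rw [sum_range_succ, mul_add, ih, Real.two_mul_sin_mul_cos]
    have h1 : θ - (2 * ((M : ℕ) : ℝ) + 1 - N) * θ = -((2 * (M : ℝ) - N) * θ) := by ring
    have h2 : θ + (2 * ((M : ℕ) : ℝ) + 1 - N) * θ = (2 * ((M + 1 : ℕ) : ℝ) - N) * θ := by push_cast; ring
    rw [h1, h2, Real.sin_neg]; ring

/-- Over a full period the twisted cosine sum vanishes off the diagonal: for `x ≠ y` in `Fin S`,
`∑_{j<S} cos(k_j (x - y)) = 0`. -/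
theorem sum_cos_twisted_full_of_ne {S : ℕ} (N : ℕ) {x y : Fin S} (hxy : x ≠ y) :
    ∑ j ∈ range S, Real.cos (twistedMomentum S N j * ((x : ℝ) - y)) = 0 := by
  have hS : (0 : ℝ) < S := by
    have : 0 < S := Fin.pos x
    exact_mod_cast this
  set θ : ℝ := π * ((x : ℝ) - y) / S with hθ
  have hre : ∀ j : ℕ, twistedMomentum S N j * ((x : ℝ) - y) = (2 * (j : ℝ) + 1 - N) * θ := by
    intro j; simp only [twistedMomentum, hθ]; ring
  simp_rw [hre]
  have htel := two_sin_mul_sum_cos N S θ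
  -- sin((2S - N)θ) = sin(-Nθ + (x - y) * 2π) = -sin(Nθ)
  have hper : Real.sin ((2 * (S : ℝ) - N) * θ) = -Real.sin (N * θ) := by
    have : (2 * (S : ℝ) - N) * θ = -(N * θ) + (((x : ℤ) - y : ℤ) : ℝ) * (2 * π) := by
      rw [hθ]; push_cast; field_simp; ring
    rw [this, Real.sin_add_int_mul_two_pi, Real.sin_neg]
  rw [hper, neg_add_cancel] at htel
  -- sin θ ≠ 0 because -π < θ < π and θ ≠ 0
  have hxyR : ((x : ℝ) - y) ≠ 0 := by
    have : (x : ℝ) ≠ (y : ℝ) := by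
      intro h; apply hxy; exact Fin.ext (by exact_mod_cast h)
    exact sub_ne_zero.mpr this
  have hlt : |(x : ℝ) - y| < S := by
    have hx : ((x : ℕ) : ℝ) < S := by exact_mod_cast x.isLt
    have hy : ((y : ℕ) : ℝ) < S := by exact_mod_cast y.isLt
    have hx0 : (0 : ℝ) ≤ (x : ℕ) := by positivity
    have hy0 : (0 : ℝ) ≤ (y : ℕ) := by positivity
    rw [abs_lt]; constructor <;> linarith
  have hθlt : |θ| < π := by
    rw [hθ, abs_div, abs_mul, abs_of_pos Real.pi_pos, abs_of_pos hS, div_lt_iff₀ hS]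
    nlinarith [Real.pi_pos]
  have hsin : Real.sin θ ≠ 0 := by
    intro h0
    have := (Real.sin_eq_zero_iff_of_lt_of_lt (abs_lt.mp hθlt).1 (abs_lt.mp hθlt).2).mp h0
    rw [hθ] at this
    have : π * ((x : ℝ) - y) = 0 := by
      rcases div_eq_zero_iff.mp this with h | h
      · exact h
      · exact absurd h hS.ne'
    rcases mul_eq_zero.mp this with h | h
    · exact Real.pi_ne_zero h
    · exact hxyR h
  have h2 : (2 * Real.sin θ) ≠ 0 := mul_ne_zero two_ne_zero hsin
  exact (mul_eq_zero.mp htel).resolve_left h2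

/-- On the diagonal every term is `cos 0 = 1`. -/
theorem sum_cos_twisted_full_self {S : ℕ} (N M : ℕ) (x : Fin S) :
    ∑ j ∈ range M, Real.cos (twistedMomentum S N j * ((x : ℝ) - x)) = M := by
  simp

/-- `g_N(0) = N / S`. -/
theorem twistedSection_zero (S N : ℕ) : twistedSection S N 0 = N / S := by
  simp [twistedSection]

/-- `g_N(1) = sin(Nπ/S) / (S sin(π/S))` for `S ≥ 2`. -/
theorem twistedSection_one (S N : ℕ) (hS : 2 ≤ S) :
    twistedSection S N 1 = Real.sin (N * π / S) / (S * Real.sin (π / S)) := by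
  have hS0 : (0 : ℝ) < S := by exact_mod_cast (lt_of_lt_of_le (by norm_num) hS : 0 < S)
  have hsin : Real.sin (π / S) ≠ 0 := by
    have h1 : 0 < π / S := div_pos Real.pi_pos hS0
    have h2 : π / S < π := by
      rw [div_lt_iff₀ hS0]
      have : (2 : ℝ) ≤ S := by exact_mod_cast hS
      nlinarith [Real.pi_pos]
    exact (Real.sin_pos_of_pos_of_lt_pi h1 h2).ne'
  have htel := two_sin_mul_sum_cos N N (π / S)
  have hre : ∀ j : ℕ, twistedMomentum S N j * ((1 : ℕ) : ℝ) = (2 * (j : ℝ) + 1 - N) * (π / S) := by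
    intro j; simp [twistedMomentum]
  simp only [twistedSection]
  simp_rw [hre]
  have h2 : (2 * (N : ℝ) - N) * (π / S) = N * π / S := by ring
  have h3 : (N : ℝ) * (π / S) = N * π / S := by ring
  rw [h2, h3, ← two_mul] at htel
  set A := ∑ j ∈ range N, Real.cos ((2 * (j : ℝ) + 1 - N) * (π / S)) with hA
  -- htel : 2 * sin(π/S) * A = 2 * sin(Nπ/S)
  have hsum : A * Real.sin (π / S) = Real.sin (N * π / S) := by linarith [htel]
  rw [div_eq_div_iff hS0.ne' (mul_ne_zero hS0.ne' hsin), ← hsum]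
  ring

/-- `cos (k ⬝ natDist x y) = cos (k x - k y)` for the symmetric natural-number distance used by
`toeplitzSection`. -/
theorem cos_mul_natDist (k : ℝ) (a b : ℕ) :
    Real.cos (k * (((a - b) + (b - a) : ℕ) : ℝ)) = Real.cos (k * a - k * b) := by
  rcases le_total a b with h | h
  · rw [Nat.sub_eq_zero_of_le h, zero_add, Nat.cast_sub h, ← Real.cos_neg]
    congr 1; ring
  · rw [Nat.sub_eq_zero_of_le h, add_zero, Nat.cast_sub h]
    congr 1; ring

/-- Gram factors over the occupied momenta. -/
noncomputable def cosOcc (S N : ℕ) : Matrix (Fin S) (Fin N) ℝ :=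
  Matrix.of fun x j => Real.cos (twistedMomentum S N j * x)

/-- Gram factors over the occupied momenta (sine part). -/
noncomputable def sinOcc (S N : ℕ) : Matrix (Fin S) (Fin N) ℝ :=
  Matrix.of fun x j => Real.sin (twistedMomentum S N j * x)

/-- Gram factors over the unoccupied momenta `k_{N+j}`, `j < S - N`. -/
noncomputable def cosUnocc (S N : ℕ) : Matrix (Fin S) (Fin (S - N)) ℝ :=
  Matrix.of fun x j => Real.cos (twistedMomentum S N (N + j) * x)

/-- Gram factors over the unoccupied momenta (sine part). -/
noncomputable def sinUnocc (S N : ℕ) : Matrix (Fin S) (Fin (S - N)) ℝ :=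
  Matrix.of fun x j => Real.sin (twistedMomentum S N (N + j) * x)

/-- `T_S(g_N) = (1/S) (C Cᴴ + S Sᴴ)` over the occupied momenta. -/
theorem toeplitzSection_twisted_eq (S N : ℕ) :
    toeplitzSection S (twistedSection S N)
      = (1 / (S : ℝ)) • (cosOcc S N * (cosOcc S N)ᴴ + sinOcc S N * (sinOcc S N)ᴴ) := by
  ext x y
  simp only [toeplitzSection_apply, twistedSection, Matrix.smul_apply, Matrix.add_apply, Matrix.mul_apply,
    Matrix.conjTranspose_apply, cosOcc, sinOcc, Matrix.of_apply, star_trivial, smul_eq_mul]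
  rw [Fin.sum_univ_eq_sum_range (fun j => Real.cos (twistedMomentum S N j * x) *
        Real.cos (twistedMomentum S N j * y)) N,
      Fin.sum_univ_eq_sum_range (fun j => Real.sin (twistedMomentum S N j * x) *
        Real.sin (twistedMomentum S N j * y)) N,
      ← sum_add_distrib, div_eq_inv_mul, one_div]
  congr 1
  refine sum_congr rfl fun j _ => ?_
  rw [cos_mul_natDist, Real.cos_sub]

/-- `1 - T_S(g_N) = (1/S) (C' C'ᴴ + S' S'ᴴ)` over the unoccupied momenta (completeness of the
twisted Fourier basis). -/
theorem one_sub_toeplitzSection_twisted_eq (S N : ℕ) (hN : N ≤ S) :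
    1 - toeplitzSection S (twistedSection S N)
      = (1 / (S : ℝ)) • (cosUnocc S N * (cosUnocc S N)ᴴ + sinUnocc S N * (sinUnocc S N)ᴴ) := by
  ext x y
  have hS : (0 : ℝ) < S := by exact_mod_cast (Fin.pos x)
  simp only [Matrix.sub_apply, toeplitzSection_apply, twistedSection, Matrix.smul_apply, Matrix.add_apply, Matrix.mul_apply,
    Matrix.conjTranspose_apply, cosUnocc, sinUnocc, Matrix.of_apply, star_trivial, smul_eq_mul]
  rw [Fin.sum_univ_eq_sum_range (fun j => Real.cos (twistedMomentum S N (N + j) * x) *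
        Real.cos (twistedMomentum S N (N + j) * y)) (S - N),
      Fin.sum_univ_eq_sum_range (fun j => Real.sin (twistedMomentum S N (N + j) * x) *
        Real.sin (twistedMomentum S N (N + j) * y)) (S - N),
      ← sum_add_distrib]
  have hocc : ∑ j ∈ range N, Real.cos (twistedMomentum S N j * ((((x : ℕ) - y) + ((y : ℕ) - x) : ℕ) : ℝ))
      = ∑ j ∈ range N, Real.cos (twistedMomentum S N j * ((x : ℝ) - y)) := by
    refine sum_congr rfl fun j _ => ?_
    rw [cos_mul_natDist, mul_sub]
  have hun : ∑ j ∈ range (S - N), (Real.cos (twistedMomentum S N (N + j) * x) *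
        Real.cos (twistedMomentum S N (N + j) * y) + Real.sin (twistedMomentum S N (N + j) * x) *
        Real.sin (twistedMomentum S N (N + j) * y))
      = ∑ j ∈ range (S - N), Real.cos (twistedMomentum S N (N + j) * ((x : ℝ) - y)) := by
    refine sum_congr rfl fun j _ => ?_
    rw [mul_sub, Real.cos_sub]
  rw [hocc, hun]
  -- full period: Σ_{j<N} + Σ_{j<S-N} (shifted) = Σ_{j<S}
  have hfull : ∑ j ∈ range N, Real.cos (twistedMomentum S N j * ((x : ℝ) - y))
      + ∑ j ∈ range (S - N), Real.cos (twistedMomentum S N (N + j) * ((x : ℝ) - y))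
      = ∑ j ∈ range S, Real.cos (twistedMomentum S N j * ((x : ℝ) - y)) := by
    rw [← sum_range_add]
    rw [Nat.add_sub_cancel' hN]
  by_cases hxy : x = y
  · subst hxy
    have e1 : ∀ k : ℝ, Real.cos (k * ((x : ℝ) - x)) = 1 := by intro k; simp
    simp only [Matrix.one_apply_eq, e1, sum_const, card_range, nsmul_eq_mul, mul_one, Nat.cast_sub hN]
    field_simp
  · rw [Matrix.one_apply_ne hxy]
    have h0 := sum_cos_twisted_full_of_ne N hxy
    rw [← hfull] at h0
    have : ∑ j ∈ range (S - N), Real.cos (twistedMomentum S N (N + j) * ((x : ℝ) - y))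
        = -∑ j ∈ range N, Real.cos (twistedMomentum S N j * ((x : ℝ) - y)) := by linarith
    rw [this]
    ring

/-- MAIN: the twisted-ring section is feasible for the one-body section problem and has the
envelope values `g(0) = N/S`, `g(1) = sin(Nπ/S)/(S sin(π/S))`. -/
theorem twistedSection_feasible (S N : ℕ) (hS : 2 ≤ S) (hN : N ≤ S) :
    (toeplitzSection S (twistedSection S N)).PosSemidef ∧
      (1 - toeplitzSection S (twistedSection S N)).PosSemidef ∧
      twistedSection S N 0 = N / S ∧
      twistedSection S N 1 = Real.sin (N * π / S) / (S * Real.sin (π / S)) := by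
  have hS0 : (0 : ℝ) ≤ 1 / (S : ℝ) := by positivity
  refine ⟨?_, ?_, twistedSection_zero S N, twistedSection_one S N hS⟩
  · rw [toeplitzSection_twisted_eq]
    exact ((posSemidef_self_mul_conjTranspose _).add (posSemidef_self_mul_conjTranspose _)).smul hS0
  · rw [one_sub_toeplitzSection_twisted_eq S N hN]
    exact ((posSemidef_self_mul_conjTranspose _).add (posSemidef_self_mul_conjTranspose _)).smul hS0

/-- Consequence with `hop_le_diag`: the envelope never exceeds the density, i.e.
`sin(Nπ/S)/(S sin(π/S)) ≤ N/S` — a sanity corollary tying the certificate to the landed block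
inequalities. -/
theorem envelope_le_density (S N : ℕ) (hS : 2 ≤ S) (hN : N ≤ S) :
    Real.sin (N * π / S) / (S * Real.sin (π / S)) ≤ N / S := by
  obtain ⟨hT, -, h0, h1⟩ := twistedSection_feasible S N hS hN
  rw [← h0, ← h1]
  exact hop_le_diag hS hT

end Summit.Ventures.CertifiedManyBodySolver.Conjectures
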